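import Summits.ResolutionOfSingularities.ResolutionOfSingularities.Theorems.WeightedInvariantWeightedConstructionExtReesWeighted
import HarnessLib

/-!
# The strict transform modulo `t⁻¹` is generated by the initial forms (Włodarczyk, Lemma 4.1.7)

Topic: `Summits/ResolutionOfSingularities/ResolutionOfSingularities/Theorems`. Stub
`stub_initialIdeal` of the line `no-phi-rays-static-drop` of the crux
`Theses.WeightedInvariant.WeightedConstruction` (statement `stmt-ResolutionOfSingularities-0571`)
of the summit `Summit.ResolutionOfSingularities.ResolutionOfSingularities`.

Ring-level form of J. Włodarczyk, *Functorial resolution by torus actions*, arXiv:2203.03090,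
Lemma 4.1.7 ("the restriction of the strict transform `σˢ(I)` to the exceptional divisor
`V(t⁻¹) = Spec gr_J 𝒪_X` is the initial ideal `in_J(I)`"). Notation: `A` any commutative ring,
`u : Fin m → A` with weights `w : Fin m → ℕ`, `Jₙ = weightedMonomialIdeal u w n = (u^α : Σ wᵢ αᵢ ≥ n)`,
`S = A[t⁻¹, Jₙ tⁿ] = extReesAlgebra J ⊆ A[t, t⁻¹]` (`WeightedResolutionDatum.lean`),
`s = t⁻¹ = extReesAlgebra.tInv J`, `σˢ(𝔞) = extReesAlgebra.strictTransform J 𝔞` the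
`s`-saturation of `𝔞 S` (W 3.3.12). The statement:

  `σˢ(𝔞) + (s) = (s) + (a tⁿ : n ≥ 0, a ∈ 𝔞 ∩ Jₙ)`.

Proof.
* `⊇`: `sⁿ · (a tⁿ) = a ∈ 𝔞 S`, so `a tⁿ ∈ σˢ(𝔞)` (`mem_strictTransform_of_coe_eq`).
* `⊆`: if `sᵏ g ∈ 𝔞 S` then every Laurent coefficient of `sᵏ g`, hence (shift by `k`,
  `coeff_tInv_pow_mul`) of `g`, lies in `𝔞` (`coeff_mem_of_mem_map`: `𝔞 S` dies in
  `(A/𝔞)[t, t⁻¹]`); the coefficient of `tⁿ`, `n ≥ 0`, of any `g ∈ S` lies in `Jₙ`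
  (`coeff_mem_weightedMonomialIdeal`, through the bridge `S = cobordantAlgebra u w = ⊕ₙ 𝒥ₙ tⁿ`,
  `stub_extReesAlgebra_weighted` + `cobordantAlgebra_eq_extendedRees`); finally split
  `g = Σⱼ cⱼ tʲ` (`mem_sup_of_coeff_mem`): `cⱼ tʲ = cⱼ s^{-j} ∈ (s)` for `j < 0` and `cₙ tⁿ` is a
  generator for `n ≥ 0`.

Everything is elementary commutative algebra over an arbitrary commutative ring (no Noetherian or
regularity hypothesis).
-/

noncomputable section

open CategoryTheory AlgebraicGeometry TopologicalSpace
open Literature.AlgebraicGeometry.Resolution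
open LaurentPolynomial
open scoped LaurentPolynomial

set_option linter.dupNamespace false -- mandated namespace of this single-conjunct summit

namespace Summit.ResolutionOfSingularities.ResolutionOfSingularities.Theorems

namespace InitialIdeal

section General

variable {A : Type} [CommRing A] (I : ℕ → Ideal A)

-- adapted from `IdealFiltration.coeff_T_neg_one_pow_mul` (ExtendedReesSaturation.lean)
/-- Multiplying by `sⁿ = t⁻ⁿ` shifts the Laurent coefficients by `n`. [folklore] -/
theorem coeff_tInv_pow_mul (x : extReesAlgebra I) (n : ℕ) (j : ℤ) :
    ((extReesAlgebra.tInv I ^ n * x : extReesAlgebra I) : A[T;T⁻¹]).coeff j =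
      (x : A[T;T⁻¹]).coeff (j + n) := by
  rw [MulMemClass.coe_mul, SubmonoidClass.coe_pow, extReesAlgebra.coe_tInv, T_pow,
    show (T (n * (-1 : ℤ)) : A[T;T⁻¹]) = AddMonoidAlgebra.single (-(n : ℤ)) 1 by
      rw [T]; congr 1; ring,
    AddMonoidAlgebra.coeff_single_mul_apply, one_mul]
  congr 1
  ring

-- adapted from `IdealFiltration.coeff_mem_of_mem_map` (ExtendedReesSaturation.lean)
/-- Every Laurent coefficient of an element of `𝔞 S`, `S = A[t⁻¹, Iₙ tⁿ]`, lies in `𝔞`: the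
reduction `S → (A/𝔞)[t, t⁻¹]` kills `𝔞 S`. [folklore] -/
theorem coeff_mem_of_mem_map (𝔞 : Ideal A) {x : extReesAlgebra I}
    (hx : x ∈ 𝔞.map (algebraMap A (extReesAlgebra I))) (j : ℤ) :
    (x : A[T;T⁻¹]).coeff j ∈ 𝔞 := by
  let ρ : extReesAlgebra I →+* (A ⧸ 𝔞)[T;T⁻¹] :=
    (AddMonoidAlgebra.mapRingHom ℤ (Ideal.Quotient.mk 𝔞)).comp (extReesAlgebra I).val.toRingHom
  have hρ : ∀ (y : extReesAlgebra I) (i : ℤ),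
      (ρ y).coeff i = Ideal.Quotient.mk 𝔞 ((y : A[T;T⁻¹]).coeff i) := fun y i => by
    simp [ρ]
  have hker : 𝔞.map (algebraMap A (extReesAlgebra I)) ≤ RingHom.ker ρ := by
    refine Ideal.map_le_iff_le_comap.mpr fun a ha => ?_
    rw [Ideal.mem_comap, RingHom.mem_ker]
    apply LaurentPolynomial.ext
    intro i
    rw [hρ]
    change Ideal.Quotient.mk 𝔞 ((C a : A[T;T⁻¹]).coeff i) = 0
    rw [← single_eq_C, AddMonoidAlgebra.coeff_single, Finsupp.single_apply]
    split_ifs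
    · exact Ideal.Quotient.eq_zero_iff_mem.mpr ha
    · rw [map_zero]
  have h := congrArg (fun q : (A ⧸ 𝔞)[T;T⁻¹] => q.coeff j) (RingHom.mem_ker.mp (hker hx))
  simp only [hρ] at h
  exact Ideal.Quotient.eq_zero_iff_mem.mp (by simpa using h)

/-- The initial form `a tⁿ` of an element `a ∈ 𝔞` (`n ≥ 0`) lies in the strict transform:
`sⁿ · (a tⁿ) = a ∈ 𝔞 S`. [folklore] -/
theorem mem_strictTransform_of_coe_eq (𝔞 : Ideal A) {x : extReesAlgebra I} {n : ℕ} {a : A}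
    (ha : a ∈ 𝔞) (hx : (x : A[T;T⁻¹]) = C a * T (n : ℤ)) :
    x ∈ extReesAlgebra.strictTransform I 𝔞 := by
  refine (extReesAlgebra.mem_strictTransform_iff I).mpr ⟨n, ?_⟩
  have e : extReesAlgebra.tInv I ^ n * x = algebraMap A (extReesAlgebra I) a := by
    apply Subtype.ext
    rw [MulMemClass.coe_mul, SubmonoidClass.coe_pow, extReesAlgebra.coe_tInv, hx,
      Subalgebra.coe_algebraMap, ← C_eq_algebraMap, T_pow, mul_left_comm, ← T_add,
      show (n : ℤ) * (-1 : ℤ) + (n : ℤ) = 0 by ring, T_zero, mul_one]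
  rw [e]
  exact Ideal.mem_map_of_mem _ ha

/-- **Decomposition into homogeneous components.** An element `g` of `S = A[t⁻¹, Iₙ tⁿ]` all of
whose Laurent coefficients lie in `𝔞`, and whose coefficient of `tⁿ` lies in `Iₙ` for every
`n ≥ 0`, lies in `(s) + (a tⁿ : n ≥ 0, a ∈ 𝔞 ∩ Iₙ)`: write `g = Σⱼ cⱼ tʲ`; for `j = -k < 0`,
`cⱼ tʲ = cⱼ sᵏ ∈ (s)`, and for `j = n ≥ 0` the monomial `cₙ tⁿ` is one of the generators.
[folklore] -/
theorem mem_sup_of_coeff_mem (𝔞 : Ideal A) (g : extReesAlgebra I)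
    (h𝔞 : ∀ j : ℤ, (g : A[T;T⁻¹]).coeff j ∈ 𝔞)
    (hI : ∀ n : ℕ, (g : A[T;T⁻¹]).coeff (n : ℤ) ∈ I n) :
    g ∈ Ideal.span {extReesAlgebra.tInv I} ⊔
      Ideal.span {x | ∃ (n : ℕ) (a : A), a ∈ 𝔞 ∧ a ∈ I n ∧
        (x : A[T;T⁻¹]) = C a * T (n : ℤ)} := by
  set K := Ideal.span {extReesAlgebra.tInv I} ⊔
      Ideal.span {x | ∃ (n : ℕ) (a : A), a ∈ 𝔞 ∧ a ∈ I n ∧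
        (x : A[T;T⁻¹]) = C a * T (n : ℤ)}
  -- the predicate "`p ∈ S` and, as an element of `S`, `p ∈ K`" is additive on `A[t, t⁻¹]`
  let P : A[T;T⁻¹] → Prop := fun p =>
    ∃ hp : p ∈ extReesAlgebra I, (⟨p, hp⟩ : extReesAlgebra I) ∈ K
  have hP : ∀ y : extReesAlgebra I, y ∈ K → P y := fun y hy => ⟨y.2, hy⟩
  suffices h : P g by
    obtain ⟨_, h⟩ := h
    exact h
  rw [← AddMonoidAlgebra.sum_coeff_single (g : A[T;T⁻¹]), Finsupp.sum]
  refine Finset.sum_induction _ P (fun p q hp hq => ?_) ⟨zero_mem _, K.zero_mem⟩ ?_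
  · obtain ⟨hp, hp'⟩ := hp
    obtain ⟨hq, hq'⟩ := hq
    exact ⟨add_mem hp hq, K.add_mem hp' hq'⟩
  intro j _
  rw [single_eq_C_mul_T]
  rcases lt_or_ge j 0 with hj | hj
  · -- `j = -k`, `k ≥ 1`: `c t⁻ᵏ = c · sᵏ ∈ (s)`
    obtain ⟨k, rfl⟩ := Int.exists_eq_neg_ofNat hj.le
    have hk : 0 < k := by omega
    have e : ((algebraMap A (extReesAlgebra I) ((g : A[T;T⁻¹]).coeff (-(k : ℤ))) *
        extReesAlgebra.tInv I ^ k : extReesAlgebra I) : A[T;T⁻¹]) =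
        C ((g : A[T;T⁻¹]).coeff (-(k : ℤ))) * T (-(k : ℤ)) := by
      rw [MulMemClass.coe_mul, SubmonoidClass.coe_pow, Subalgebra.coe_algebraMap,
        extReesAlgebra.coe_tInv, T_pow, ← C_eq_algebraMap, mul_neg_one]
    rw [← e]
    exact hP _ (Ideal.mem_sup_left (Ideal.mul_mem_left _ _
      (Ideal.pow_mem_of_mem _ (Ideal.mem_span_singleton_self _) k hk)))
  · -- `j = n ≥ 0`: `cₙ tⁿ` is a generator (`cₙ ∈ 𝔞 ∩ Iₙ`)
    obtain ⟨n, rfl⟩ := Int.eq_ofNat_of_zero_le hj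
    have hmem : C ((g : A[T;T⁻¹]).coeff (n : ℤ)) * T (n : ℤ) ∈ extReesAlgebra I := by
      rcases Nat.eq_zero_or_pos n with rfl | hn
      · rw [Nat.cast_zero, T_zero, mul_one, C_eq_algebraMap]
        exact Subalgebra.algebraMap_mem _ _
      · exact extReesAlgebra.C_mul_T_mem I hn (hI n)
    exact ⟨hmem, Ideal.mem_sup_right (Ideal.subset_span ⟨n, _, h𝔞 n, hI n, rfl⟩)⟩

end General

section Weighted

variable {A : Type} [CommRing A] {m : ℕ} (u : Fin m → A) (w : Fin m → ℕ)

/-- The library's `𝒥ₙ = span (weightedMonomials u w n)` (exponents `Fin m →₀ ℕ`) is contained in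
the datum's `weightedMonomialIdeal u w n` (exponents `Fin m → ℕ`); the two are in fact equal.
[folklore] -/
theorem weightedFiltration_ideal_le (n : ℕ) :
    (weightedFiltration u w).ideal n ≤ weightedMonomialIdeal u w n := by
  rw [weightedFiltration_ideal, weightedMonomialIdeal]
  refine Ideal.span_mono ?_
  rintro _ ⟨α, hα, rfl⟩
  refine ⟨⇑α, ?_, ?_⟩
  · rw [Finsupp.weight_apply, Finsupp.sum_fintype _ _ (fun i => by simp)] at hα
    simpa [smul_eq_mul, mul_comm] using hα
  · rw [Finsupp.prod_fintype _ _ (fun i => by simp)]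

/-- The coefficient of `tⁿ` (`n ≥ 0`) of an element of `A[t⁻¹, 𝒥ₙ tⁿ] = A[t⁻¹, uᵢ t^{wᵢ}] = ⊕ₙ 𝒥ₙ tⁿ`
lies in `𝒥ₙ = (u^α : Σ wᵢ αᵢ ≥ n)`. [folklore] -/
theorem coeff_mem_weightedMonomialIdeal (g : extReesAlgebra (weightedMonomialIdeal u w)) (n : ℕ) :
    (g : A[T;T⁻¹]).coeff (n : ℤ) ∈ weightedMonomialIdeal u w n := by
  have hg : (g : A[T;T⁻¹]) ∈ (weightedFiltration u w).extendedRees := by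
    rw [← cobordantAlgebra_eq_extendedRees, ← stub_extReesAlgebra_weighted u w]
    exact g.2
  exact weightedFiltration_ideal_le u w n (((weightedFiltration u w).mem_extendedRees_iff.mp hg) n)

end Weighted

end InitialIdeal

/-- **Włodarczyk's Lemma 4.1.7 at ring level** (stub `stub_initialIdeal`): in the affine model
`S = A[t⁻¹, 𝒥ₙ tⁿ] = A[t⁻¹, uᵢ t^{wᵢ}]` of the full cobordant blow-up of the weighted centre
`(u₁^{1/w₁}, …, uₘ^{1/wₘ})`, the strict transform `σˢ(𝔞)` (the `s`-saturation of `𝔞 S`,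
`s = t⁻¹`) of an ideal `𝔞 ≤ A` and the exceptional equation `s` generate the same ideal as `s`
and the INITIAL FORMS `a tⁿ` of the elements `a ∈ 𝔞 ∩ 𝒥ₙ`:
`σˢ(𝔞) + (s) = (s) + (a tⁿ : n ≥ 0, a ∈ 𝔞 ∩ 𝒥ₙ)` — i.e. `σˢ(𝔞)|_{V(s)}` is the initial ideal of
`𝔞` in `S/(s) = gr_𝒥 A`. `⊇`: `sⁿ (a tⁿ) = a ∈ 𝔞 S`. `⊆`: all Laurent coefficients of an element
of `σˢ(𝔞)` lie in `𝔞` (they are shifts of those of an element of `𝔞 S`), its `tⁿ`-coefficient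
lies in `𝒥ₙ`, and splitting it into monomials `cⱼ tʲ` gives multiples of `s` (`j < 0`) and
initial forms (`j ≥ 0`). Valid over any commutative ring. [cite: Wlodarczyk2022, Lemma 4.1.7] -/
theorem stub_initialIdeal :
    ∀ {A : Type} [CommRing A] {m : ℕ} (u : Fin m → A) (w : Fin m → ℕ) (𝔞 : Ideal A),
      extReesAlgebra.strictTransform (weightedMonomialIdeal u w) 𝔞 ⊔
          Ideal.span {extReesAlgebra.tInv (weightedMonomialIdeal u w)} =
        Ideal.span {extReesAlgebra.tInv (weightedMonomialIdeal u w)} ⊔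
          Ideal.span {x | ∃ (n : ℕ) (a : A), a ∈ 𝔞 ∧ a ∈ weightedMonomialIdeal u w n ∧
            (x : A[T;T⁻¹]) = LaurentPolynomial.C a * LaurentPolynomial.T (n : ℤ)} := by
  intro A _ _ u w 𝔞
  apply le_antisymm
  · refine sup_le (fun g hg => ?_) le_sup_left
    obtain ⟨k, hk⟩ := (extReesAlgebra.mem_strictTransform_iff _).mp hg
    refine InitialIdeal.mem_sup_of_coeff_mem _ 𝔞 g (fun j => ?_)
      (InitialIdeal.coeff_mem_weightedMonomialIdeal u w g)
    have h := InitialIdeal.coeff_mem_of_mem_map _ 𝔞 hk (j - k)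
    rwa [InitialIdeal.coeff_tInv_pow_mul, sub_add_cancel] at h
  · refine sup_le le_sup_right (Ideal.span_le.mpr ?_)
    rintro x ⟨n, a, ha, -, hx⟩
    exact Ideal.mem_sup_left (InitialIdeal.mem_strictTransform_of_coe_eq _ 𝔞 ha hx)

end Summit.ResolutionOfSingularities.ResolutionOfSingularities.Theorems

end
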